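import Summits.HodgeConjecture.HodgeConjecture.Theorems.SiegelUniversalFamilyHodgeFrames
import Literature.AlgebraicGeometry.HodgeTheory.TorsionReadingsFlatFrame
import Literature.AlgebraicGeometry.AbelianSchemes.AbelianSchemeOverFibreIdentity
import Literature.AlgebraicGeometry.AbelianSchemes.AbelianSchemeOverRestrictPt
import Literature.AlgebraicGeometry.ModuliOfAbelianVarieties.SiegelPairingReadOfTypeFrame
import Literature.AlgebraicGeometry.HodgeTheory.FermatHypersurfaceReduction
import Literature.AlgebraicGeometry.HodgeTheory.RelativeHyperplaneClassHodgeRiemann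
import Literature.AlgebraicGeometry.HodgeTheory.MotivatedClassesDeformation
import Literature.AlgebraicGeometry.Motives.ComplexPointsParacompact
import HarnessLib

/-!
# U-e P4 (B2b), pins: the PINNED identification `e x = (fibreAVIso ≪≫ fiberUnivIso⁻¹)(ℂ)` of the fibres of the universal
# family respects sections and powers; two torus lemmas

Cell hodgecm-mathlib (D-0151), rung 0 of the Mumford line under `HDel` (item `stmt-HodgeConjecture-24835`), (U)-HEAD third
layer, node U-e, socket P4, composite (B2) `UHead.Ue_P4b2_flatLevelReading` (P4 lead B-p03, sockets of record
`B-provers/B-p03/Ue-P4-sockets.v0.7.B-p03g13.lean` :722); hands B-p18 (g15) (§0–§2 and the plan) and B-p16 (g12) (§3–§5).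
THEOREMS ONLY (no definition, no named fact, no instance, no `sorry`); books 0.  HC_CM is proved only modulo the 7 printed
citations until rung 0 closes; nothing here changes that count.  Consumer: `UeP4bFlatLevelReadings` (the head
`levelSection_eq_r_of_flatFrame`).

For a Siegel fine moduli scheme `𝓜`, a complex point `t` of `M ⊗ ℂ`, and a triple `P′` over `Spec ℂ` which is the pull-back of
the universal triple along the `ℚ`-side reading of `t` via `(G, Ĝ)` ([MumfordFogartyKirwan1994] Def. 7.2/7.3: «`X ×_S T` AS GROUP
SCHEMES, `σᵢ ×_S T`», the tree's `PolarizedAbelianSchemeWithLevel.IsBaseChangeVia`), the (U)-road identifies the marked abelian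
variety `((P′.A)_𝟙)(ℂ)` with the fibre `X_t(ℂ)` of `X ⊗ ℂ → M ⊗ ℂ` through the PINNED homeomorphism
`e := (fibreAVIso P′ ≪≫ (fiberUnivIsoOfIsBaseChangeVia 𝓜 t P′ G Ĝ h)⁻¹)(ℂ)`.  This file reads the four pins of `e` off `h`:
* §0 `pullbackId_hom_app_left` — the identity-fibre isomorphism `Over.pullbackId` is `pullback.fst` on underlying objects;
* §1 `pow_left_comp_eq_of_isBaseChangeVia` — powers of points go through a base change of group schemes;
* §2 `pow_left_comp_fst_fibreId` — powers of points of the identity fibre go through `pullback.fst`;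
* §3 `eq_of_left_comp_baseChangeHomFst_eq` — a complex point of `Y ⊗_ℚ ℂ` is determined by its `Y`-coordinate;
* §4 (P2) `left_map_fiberι_pinned_comp_fst` — the `𝒳`-coordinate of `e Q` is `Q ≫ fst ≫ G`; (P3) `map_fiberι_pinned_restrictPt`
  — SECTIONS: `e (σ′ᵢ(𝟙))` pushed into `X ⊗ ℂ` is the complex point `(σᵢ ⊗ ℂ)(t)`; (P4) `map_fiberι_pinned_pow` — POWERS:
  `e (Q ^ N)` pushed into `X ⊗ ℂ` is `([N] ⊗ ℂ)` of `e Q`;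
* §5 `proj_nsmul`, `exists_eq_proj_intCast_div_of_nsmul_eq_zero` (an `N`-torsion point of `ℝ^ι/ℤ^ι` is `[w/N]`),
  `proj_intCast_div_eq_of_intCast_eq` (`[w/N]` depends only on `w mod N`).

Lean note (B-p18's lesson, kept): `(Over.mk f).left`, `(𝟙_ (Over S)).left`, `(specOver ℚ ℂ).left` are `rfl`-equal to the
underlying objects but NOT at instances transparency, so the proofs below state auxiliary equalities with explicit objects and
close flavour seams by `exact`/`erw`/`rfl` rather than `rw`.

## References
* [MumfordFogartyKirwan1994] D. Mumford, J. Fogarty, F. Kirwan, *Geometric Invariant Theory*, 3rd ed. (1994), Ch. 7 §2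
  Definition 7.2 (p. 129), Definition 7.3 (p. 129), §3 Theorem 7.9 (p. 139).
* [GortzWedhorn2020] U. Görtz, T. Wedhorn, *Algebraic Geometry I*, 2nd ed. (2020), Section (4.7), Prop. 4.16.
* [Lange2023AbelianVarietiesComplex] H. Lange, *Abelian Varieties over the Complex Numbers* (2023), §1.1.1.
* [Hindry1998] M. Hindry, *Introduction to abelian varieties and the Mordell–Lang conjecture* (1998), §1 item 2.
-/

set_option autoImplicit false

-- mandated namespace `Summit.HodgeConjecture.HodgeConjecture.Theorems` trips `linter.dupNamespace` (single-problem summit; the lakefile turns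
-- the linter off tree-wide as a weak option), restated here so stand-alone elaboration is warning-free (as in ★ `SiegelUniversalFamilyHodgeFrames`).
set_option linter.dupNamespace false

noncomputable section

open CategoryTheory CategoryTheory.Limits AlgebraicGeometry MonoidalCategory CartesianMonoidalCategory
open _root_.Topology _root_.Filter
open scoped MonObj

namespace Summit.HodgeConjecture.HodgeConjecture.Theorems

namespace UnivFamilyLevelReadings

open Literature.AlgebraicGeometry
open Literature.AlgebraicGeometry.Motives
open Literature.AlgebraicGeometry.HodgeTheory
open Literature.AlgebraicGeometry.AbelianSchemes (PolarizedAbelianSchemeWithLevel AbelianSchemeOver)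
open Literature.AlgebraicGeometry.ModuliOfAbelianVarieties
open Literature.AlgebraicGeometry.ModuliOfAbelianVarieties.W1
open Literature.AlgebraicTopology.SingularHomology
open Literature.Geometry.Kaehler (ComplexTorus)
open Literature.NumberTheory.Adeles SiegelModuli

universe v u

/-! ### §0 The identity-fibre isomorphism `Over.pullbackId` is `pullback.fst` on underlying objects -/

/-- `(Over.pullbackId.hom.app Y).left = pullback.fst Y.hom (𝟙 X)` — Mathlib's `Over.pullbackId` is the conjugate of
`Over.mapId` across `Over.map (𝟙 X) ⊣ Over.pullback (𝟙 X)`, whose counit is `pullback.fst`. [cite: GortzWedhorn2020, Section (4.7) (pp. 107–108)] -/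
theorem pullbackId_hom_app_left {C : Type u} [Category.{v} C] [HasPullbacks C] (X : C) (Y : Over X) :
    (Over.pullbackId.hom.app Y).left = pullback.fst Y.hom (𝟙 X) := by
  simp [Over.pullbackId, Adjunction.id, Over.mapId]

/-! ### §1 Powers of points through a base change of group schemes ([MFK94] Def. 7.2: `X ×_S T` as group schemes) -/

/-- **Powers of points go through a base change of group schemes.**  If `G : X′ → X` over `g : S′ → S` is compatible with
the units and the group laws (the clauses of ★ `AbelianSchemeOver.IsBaseChangeVia`), then for every `S′`-scheme `T` and every
`T`-point `R` of `X′`, the `n`-th power of `R` (Mathlib's `Hom.group` on `T ⟶ X′`) followed by `G` is `R ≫ G` followed by the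
multiplication-by-`n` map `[n] = (𝟙 X)^n` of `X`. [cite: MumfordFogartyKirwan1994, Ch. 7 §2 Definition 7.2 (p. 129)] -/
theorem pow_left_comp_eq_of_isBaseChangeVia {S S' : Scheme.{u}} {A' : AbelianSchemeOver S'} {A : AbelianSchemeOver S}
    {g : S' ⟶ S} {G : A'.X.left ⟶ A.X.left} (w : G ≫ A.X.hom = A'.X.hom ≫ g)
    (hη : η[A'.X].left ≫ G = g ≫ η[A.X].left)
    (hμ : μ[A'.X].left ≫ G = pullback.map A'.X.hom A'.X.hom A.X.hom A.X.hom G G g w.symm w.symm ≫ μ[A.X].left)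
    {T : Over S'} (R : T ⟶ A'.X) (n : ℕ) :
    ((R ^ n).left : T.left ⟶ A'.X.left) ≫ G = (R.left ≫ G) ≫ (((𝟙 A.X : A.X ⟶ A.X) ^ n).left : A.X.left ⟶ A.X.left) := by
  have hη' : @CategoryStruct.comp Scheme _ S' A'.X.left A.X.left (η[A'.X]).left G =
      @CategoryStruct.comp Scheme _ S' S A.X.left g (η[A.X]).left := hη
  have hμ' : @CategoryStruct.comp Scheme _ (pullback A'.X.hom A'.X.hom) A'.X.left A.X.left (μ[A'.X]).left G =
      pullback.map A'.X.hom A'.X.hom A.X.hom A.X.hom G G g w.symm w.symm ≫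
        ((μ[A.X]).left : pullback A.X.hom A.X.hom ⟶ A.X.left) := hμ
  induction n with
  | zero =>
      have h1 : ((R ^ 0).left : T.left ⟶ A'.X.left) = T.hom ≫ ((η[A'.X]).left : S' ⟶ A'.X.left) := by
        rw [pow_zero, Hom.one_def]; rfl
      have h2 : (((𝟙 A.X : A.X ⟶ A.X) ^ 0).left : A.X.left ⟶ A.X.left) = A.X.hom ≫ ((η[A.X]).left : S ⟶ A.X.left) := by
        rw [pow_zero, Hom.one_def]; rfl
      rw [h1, h2, Category.assoc, hη', Category.assoc, reassoc_of% w, reassoc_of% (Over.w R)]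
  | succ n ih =>
      have h1 : ((R ^ (n + 1)).left : T.left ⟶ A'.X.left) =
          pullback.lift ((R ^ n).left : T.left ⟶ A'.X.left) (R.left : T.left ⟶ A'.X.left)
              ((Over.w (R ^ n)).trans (Over.w R).symm) ≫
            ((μ[A'.X]).left : pullback A'.X.hom A'.X.hom ⟶ A'.X.left) := by
        rw [pow_succ, Hom.mul_def]; rfl
      have h2 : (((𝟙 A.X : A.X ⟶ A.X) ^ (n + 1)).left : A.X.left ⟶ A.X.left) =
          pullback.lift (((𝟙 A.X : A.X ⟶ A.X) ^ n).left : A.X.left ⟶ A.X.left) (𝟙 A.X.left)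
              ((Over.w ((𝟙 A.X : A.X ⟶ A.X) ^ n)).trans (Category.id_comp _).symm) ≫
            ((μ[A.X]).left : pullback A.X.hom A.X.hom ⟶ A.X.left) := by
        rw [pow_succ, Hom.mul_def]; rfl
      have key : pullback.lift ((R ^ n).left : T.left ⟶ A'.X.left) (R.left : T.left ⟶ A'.X.left)
              ((Over.w (R ^ n)).trans (Over.w R).symm) ≫
            pullback.map A'.X.hom A'.X.hom A.X.hom A.X.hom G G g w.symm w.symm =
          (R.left ≫ G) ≫ pullback.lift (((𝟙 A.X : A.X ⟶ A.X) ^ n).left : A.X.left ⟶ A.X.left) (𝟙 A.X.left)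
              ((Over.w ((𝟙 A.X : A.X ⟶ A.X) ^ n)).trans (Category.id_comp _).symm) := by
        apply pullback.hom_ext
        · simp only [Category.assoc, pullback.lift_fst, pullback.lift_fst_assoc, ih]
        · simp only [Category.assoc, pullback.lift_snd, pullback.lift_snd_assoc, Category.comp_id]
      rw [h1, h2, Category.assoc, hμ', reassoc_of% key, Category.assoc]

/-! ### §2 Powers of points of the identity fibre go through `pullback.fst` ([GW20] (4.7): `A ×_S S = A` as group schemes) -/

/-- For an abelian scheme `A` over `Spec K` and a `T`-point `Q` of its identity fibre `A ×_S S` (group structure transported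
along `Over.pullback (𝟙 S)`), `(Q ^ n) ≫ fst = (Q ≫ fst) ^ n` on underlying schemes, `fst : A ×_S S → A` — because `fst`
underlies the GROUP isomorphism ★ `AbelianSchemeOver.fibreIdToGrpIso`. [cite: GortzWedhorn2020, Section (4.7) (pp. 107–108)] -/
theorem pow_left_comp_fst_fibreId {K : Type} [Field K] (A : AbelianSchemeOver (Spec (.of K)))
    {T : Over (Spec (.of K))} (Q : T ⟶ (A.fibre (𝟙 (Spec (.of K)))).toAbelianVariety.X) (n : ℕ) :
    (Q ^ n).left ≫ pullback.fst A.X.hom (𝟙 (Spec (.of K))) =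
      ((Q ≫ (AbelianSchemeOver.fibreIdToGrpIso A).hom.hom.hom : T ⟶ A.X) ^ n).left := by
  have hM : @IsMonHom (Over (Spec (.of K))) _ _ (A.fibre (𝟙 (Spec (.of K)))).toAbelianVariety.X A.X
      (A.fibre (𝟙 (Spec (.of K)))).toAbelianVariety.grpObj.toMonObj A.grpObj.toMonObj
      (AbelianSchemeOver.fibreIdToGrpIso A).hom.hom.hom := by
    change IsMonHom (AbelianSchemeOver.fibreIdToGrpIso A).hom.hom.hom
    infer_instance
  have h : (Q ^ n).left ≫ (AbelianSchemeOver.fibreIdToGrpIso A).hom.hom.hom.left =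
      ((Q ≫ (AbelianSchemeOver.fibreIdToGrpIso A).hom.hom.hom : T ⟶ A.X) ^ n).left :=
    congrArg CommaMorphism.left (@MonObj.pow_comp _ _ _ _ _ _ _ _ Q n _ hM)
  rw [AbelianSchemeOver.fibreIdToGrpIso_hom_left] at h
  exact h

/-! ### §3 A complex point of a base change `Y ⊗_ℚ ℂ` is determined by its `Y`-coordinate -/

/-- Two complex points of `Y ⊗_ℚ ℂ` with the same `Y`-coordinate `Spec ℂ → Y ⊗ ℂ → Y` coincide (the other projection, to
`Spec ℂ`, is the structure map for both). [cite: GortzWedhorn2020, Prop. 4.16] -/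
theorem eq_of_left_comp_baseChangeHomFst_eq (Y : SchemeOver ℚ)
    {R₁ R₂ : ComplexPoints ((Motives.baseChange ℚ ℂ).obj Y)}
    (h : R₁.left ≫ baseChangeHomFst (algebraMap ℚ ℂ) Y = R₂.left ≫ baseChangeHomFst (algebraMap ℚ ℂ) Y) :
    R₁ = R₂ := by
  ext : 1
  apply pullback.hom_ext
  · exact h
  · exact (Over.w R₁).trans (Over.w R₂).symm

/-! ### §4 (P2) The `𝒳`-coordinate of a point moved by the PINNED identification `e = (fibreAVIso ≪≫ fiberUnivIso⁻¹)(ℂ)` -/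

section Pins

variable {g N : ℕ} {δ : Fin g → ℕ} (𝓜 : SiegelFineModuliScheme g N δ)
  (t : ComplexPoints ((Motives.baseChange ℚ ℂ).obj 𝓜.M))
  (P' : PolarizedAbelianSchemeWithLevel g N δ (specOver ℚ ℂ).left)
  (G : P'.A.X.left ⟶ 𝓜.univ.A.X.left) (Ĝ : P'.D.hat.X.left ⟶ 𝓜.univ.D.hat.X.left)
  (h : P'.IsBaseChangeVia 𝓜.univ ((AlgPoints.baseChangeEquiv (algebraMap ℚ ℂ) 𝓜.M).symm t).left G Ĝ)

/-- **(P2) The `𝒳`-coordinate of `e Q`.**  For a complex point `Q` of the identity fibre `(P′.A)_𝟙` of a triple `P′` over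
`Spec ℂ` which is the pull-back of the universal triple along the `ℚ`-side reading of `t` via `G`, the point `e Q` of the
fibre `X_t` of `X ⊗ ℂ → M ⊗ ℂ`, `e := (fibreAVIso P′ ≪≫ fiberUnivIso⁻¹)(ℂ)`, has `𝒳`-coordinate
`Spec ℂ → X_t → X ⊗ ℂ → X` equal to `Q ≫ fst ≫ G` (`fst : P′.A ×_{Spec ℂ} Spec ℂ → P′.A`).
[cite: MumfordFogartyKirwan1994, Ch. 7 §2 Definition 7.3 (p. 129)] [cite: GortzWedhorn2020, Prop. 4.16] -/
theorem left_map_fiberι_pinned_comp_fst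
    (Q : ((P'.A.fibre (𝟙 (Spec (CommRingCat.of ℂ)))).toAbelianVariety).Points ℂ) :
    (AlgPoints.map (fiberι (univFamilyℂ 𝓜) t)
        (AlgPoints.homeomorphOfIso (L := ℂ)
          (fibreAVIso P' ≪≫ (fiberUnivIsoOfIsBaseChangeVia 𝓜 t P' G Ĝ h).symm) Q)).left ≫
      baseChangeHomFst (algebraMap ℚ ℂ) (univTotal 𝓜) =
    Q.left ≫ pullback.fst P'.A.X.hom (𝟙 (Spec (CommRingCat.of ℂ))) ≫ G := by
  obtain ⟨w, hpb, -, -⟩ := h.1.1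
  have h1 : (fibreAVIso P').hom.left = pullback.fst P'.A.X.hom (𝟙 (Spec (CommRingCat.of ℂ))) :=
    pullbackId_hom_app_left _ _
  have h3 : (fiberUnivIsoOfIsBaseChangeVia 𝓜 t P' G Ĝ h).hom.left ≫ G =
      (fiberι (univFamilyℂ 𝓜) t).left ≫ baseChangeHomFst (algebraMap ℚ ℂ) (univTotal 𝓜) :=
    fiberOverBaseChangeIsoOfIsPullback_hom_left_comp (algebraMap ℚ ℂ) (univFamily 𝓜) t P'.A.X G _
      (AlgPoints.baseChangeEquiv_symm_apply_left (σ := algebraMap ℚ ℂ) (X := 𝓜.M) t).symm hpb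
  have h6 : (fiberUnivIsoOfIsBaseChangeVia 𝓜 t P' G Ĝ h).inv.left ≫
      (fiberUnivIsoOfIsBaseChangeVia 𝓜 t P' G Ĝ h).hom.left = 𝟙 _ :=
    congrArg CommaMorphism.left (fiberUnivIsoOfIsBaseChangeVia 𝓜 t P' G Ĝ h).inv_hom_id
  have h5 : (fiberUnivIsoOfIsBaseChangeVia 𝓜 t P' G Ĝ h).inv.left ≫
      (fiberι (univFamilyℂ 𝓜) t).left ≫ baseChangeHomFst (algebraMap ℚ ℂ) (univTotal 𝓜) = G :=
    calc (fiberUnivIsoOfIsBaseChangeVia 𝓜 t P' G Ĝ h).inv.left ≫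
          (fiberι (univFamilyℂ 𝓜) t).left ≫ baseChangeHomFst (algebraMap ℚ ℂ) (univTotal 𝓜)
          = (fiberUnivIsoOfIsBaseChangeVia 𝓜 t P' G Ĝ h).inv.left ≫
            ((fiberUnivIsoOfIsBaseChangeVia 𝓜 t P' G Ĝ h).hom.left ≫ G) := by rw [h3]; rfl
      _ = ((fiberUnivIsoOfIsBaseChangeVia 𝓜 t P' G Ĝ h).inv.left ≫
            (fiberUnivIsoOfIsBaseChangeVia 𝓜 t P' G Ĝ h).hom.left) ≫ G := (Category.assoc _ _ _).symm
      _ = 𝟙 _ ≫ G := congrArg (· ≫ G) h6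
      _ = G := Category.id_comp G
  rw [AlgPoints.coe_homeomorphOfIso, AlgPoints.map_apply, AlgPoints.map_apply]
  simp only [Over.comp_left, Iso.trans_hom, Iso.symm_hom, Category.assoc]
  erw [h5, h1]
  rfl

/-- **(P3) SECTIONS: `e (σ′ᵢ(𝟙))` is the complex point `(σᵢ ⊗ ℂ)(t)` of `X ⊗ ℂ`.**  For the level section `σ′ᵢ` of the
triple `P′` (pull-back of the universal `σᵢ`: `σ′ᵢ ≫ G = s ≫ σᵢ`, the level clause of `IsBaseChangeVia`) and the universal
section read as a `ℚ`-morphism `σM : M → X` of the total space (`σM.left = σᵢ.left`), the point `e (σ′ᵢ(𝟙))` of the fibre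
`X_t`, pushed into `X ⊗ ℂ`, is `(σM ⊗ ℂ)(t)` — both have `𝒳`-coordinate `s ≫ σᵢ`.
[cite: MumfordFogartyKirwan1994, Ch. 7 §2 Definition 7.2 (p. 129) and Definition 7.3 (p. 129)] -/
theorem map_fiberι_pinned_restrictPt (i : Fin g ⊕ Fin g) (σM : 𝓜.M ⟶ univTotal 𝓜)
    (hσM : σM.left = (𝓜.univ.level.σ i).left) :
    AlgPoints.map (fiberι (univFamilyℂ 𝓜) t)
        (AlgPoints.homeomorphOfIso (L := ℂ)
          (fibreAVIso P' ≪≫ (fiberUnivIsoOfIsBaseChangeVia 𝓜 t P' G Ĝ h).symm)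
          (P'.A.restrictPt (𝟙 (Spec (CommRingCat.of ℂ))) (P'.level.σ i))) =
      AlgPoints.map ((Motives.baseChange ℚ ℂ).map σM) t := by
  apply eq_of_left_comp_baseChangeHomFst_eq (univTotal 𝓜)
  have hL : (P'.A.restrictPt (𝟙 (Spec (CommRingCat.of ℂ))) (P'.level.σ i)).left ≫
      pullback.fst P'.A.X.hom (𝟙 (Spec (CommRingCat.of ℂ))) ≫ G =
      ((AlgPoints.baseChangeEquiv (algebraMap ℚ ℂ) 𝓜.M).symm t).left ≫ (𝓜.univ.level.σ i).left := by
    rw [← Category.assoc]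
    erw [AbelianSchemeOver.restrictPt_left_fst, Category.id_comp]
    exact h.1.2 i
  have hR : (AlgPoints.map ((Motives.baseChange ℚ ℂ).map σM) t).left ≫
      baseChangeHomFst (algebraMap ℚ ℂ) (univTotal 𝓜) =
      ((AlgPoints.baseChangeEquiv (algebraMap ℚ ℂ) 𝓜.M).symm t).left ≫ (𝓜.univ.level.σ i).left := by
    have hc : ((Motives.baseChange ℚ ℂ).map σM).left ≫ baseChangeHomFst (algebraMap ℚ ℂ) (univTotal 𝓜) =
        baseChangeHomFst (algebraMap ℚ ℂ) 𝓜.M ≫ σM.left :=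
      baseChangeHom_map_left_comp_fst (algebraMap ℚ ℂ) σM
    rw [AlgPoints.baseChangeEquiv_symm_apply_left, AlgPoints.map_apply, Over.comp_left, Category.assoc, hc, hσM]
    exact (Category.assoc _ _ _).symm
  rw [left_map_fiberι_pinned_comp_fst 𝓜 t P' G Ĝ h]
  exact hL.trans hR.symm

/-- **(P4) POWERS: `e (Q ^ N) = ([N] ⊗ ℂ)(e Q)` in `X ⊗ ℂ`.**  For a complex point `Q` of the identity fibre of `P′.A` and the
multiplication-by-`N` of the universal abelian scheme read as a `ℚ`-endomorphism `nX` of the total space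
(`nX.left = ((𝟙 X)^N).left`, Mathlib's `Hom.group`), the point `e (Q ^ N)` pushed into `X ⊗ ℂ` is `(nX ⊗ ℂ)` of the point
`e Q` pushed into `X ⊗ ℂ`: powers go through the group isomorphism `(P′.A)_𝟙 ≅ P′.A` (`pow_left_comp_fst_fibreId`) and
through the base change of group schemes `G` (`pow_left_comp_eq_of_isBaseChangeVia`).
[cite: MumfordFogartyKirwan1994, Ch. 7 §2 Definition 7.2 (p. 129) and Definition 7.3 (p. 129)] -/
theorem map_fiberι_pinned_pow (n : ℕ) (nX : univTotal 𝓜 ⟶ univTotal 𝓜)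
    (hnX : nX.left = (((𝟙 𝓜.univ.A.X : 𝓜.univ.A.X ⟶ 𝓜.univ.A.X) ^ n).left : 𝓜.univ.A.X.left ⟶ 𝓜.univ.A.X.left))
    (Q : ((P'.A.fibre (𝟙 (Spec (CommRingCat.of ℂ)))).toAbelianVariety).Points ℂ) :
    AlgPoints.map (fiberι (univFamilyℂ 𝓜) t)
        (AlgPoints.homeomorphOfIso (L := ℂ)
          (fibreAVIso P' ≪≫ (fiberUnivIsoOfIsBaseChangeVia 𝓜 t P' G Ĝ h).symm) (Q ^ n)) =
      AlgPoints.map ((Motives.baseChange ℚ ℂ).map nX)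
        (AlgPoints.map (fiberι (univFamilyℂ 𝓜) t)
          (AlgPoints.homeomorphOfIso (L := ℂ)
            (fibreAVIso P' ≪≫ (fiberUnivIsoOfIsBaseChangeVia 𝓜 t P' G Ĝ h).symm) Q)) := by
  apply eq_of_left_comp_baseChangeHomFst_eq (univTotal 𝓜)
  have hc : ((Motives.baseChange ℚ ℂ).map nX).left ≫ baseChangeHomFst (algebraMap ℚ ℂ) (univTotal 𝓜) =
      baseChangeHomFst (algebraMap ℚ ℂ) (univTotal 𝓜) ≫ nX.left :=
    baseChangeHom_map_left_comp_fst (algebraMap ℚ ℂ) nX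
  have hR : (AlgPoints.map ((Motives.baseChange ℚ ℂ).map nX)
        (AlgPoints.map (fiberι (univFamilyℂ 𝓜) t)
          (AlgPoints.homeomorphOfIso (L := ℂ)
            (fibreAVIso P' ≪≫ (fiberUnivIsoOfIsBaseChangeVia 𝓜 t P' G Ĝ h).symm) Q))).left ≫
      baseChangeHomFst (algebraMap ℚ ℂ) (univTotal 𝓜) =
      ((AlgPoints.map (fiberι (univFamilyℂ 𝓜) t)
          (AlgPoints.homeomorphOfIso (L := ℂ)
            (fibreAVIso P' ≪≫ (fiberUnivIsoOfIsBaseChangeVia 𝓜 t P' G Ĝ h).symm) Q)).left ≫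
        baseChangeHomFst (algebraMap ℚ ℂ) (univTotal 𝓜)) ≫ nX.left := by
    rw [AlgPoints.map_apply, Over.comp_left, Category.assoc, hc]
    rfl
  obtain ⟨w, -, hη, hμ⟩ := h.1.1
  have h5 := pow_left_comp_fst_fibreId P'.A Q n
  have h6 := pow_left_comp_eq_of_isBaseChangeVia w hη hμ
    (Q ≫ (AbelianSchemeOver.fibreIdToGrpIso P'.A).hom.hom.hom) n
  have h56 : ((Q ^ n).left ≫ pullback.fst P'.A.X.hom (𝟙 (Spec (CommRingCat.of ℂ)))) ≫ G =
      ((Q ≫ (AbelianSchemeOver.fibreIdToGrpIso P'.A).hom.hom.hom).left ≫ G) ≫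
        (((𝟙 𝓜.univ.A.X : 𝓜.univ.A.X ⟶ 𝓜.univ.A.X) ^ n).left : 𝓜.univ.A.X.left ⟶ 𝓜.univ.A.X.left) := by
    erw [h5]
    exact h6
  have h7 : (Q ≫ (AbelianSchemeOver.fibreIdToGrpIso P'.A).hom.hom.hom).left ≫ G =
      Q.left ≫ pullback.fst P'.A.X.hom (𝟙 (Spec (CommRingCat.of ℂ))) ≫ G := by
    rw [Over.comp_left, AbelianSchemeOver.fibreIdToGrpIso_hom_left, Category.assoc]
    rfl
  rw [h7] at h56
  rw [hR, left_map_fiberι_pinned_comp_fst 𝓜 t P' G Ĝ h, left_map_fiberι_pinned_comp_fst 𝓜 t P' G Ĝ h, hnX]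
  exact (Category.assoc _ _ _).symm.trans h56

end Pins

/-! ### §5 Two torus lemmas: `N`-torsion points are `[w/N]`, and `[w/N]` depends only on `w mod N` -/

section Torus

variable {κ : Type} {V : Type} [NormedAddCommGroup V] [NormedSpace ℂ V] (Φ : (κ → ℝ) ≃L[ℝ] V)

/-- `proj` is additive in the exponent: `[n • x] = n • [x]`. [cite: Lange2023AbelianVarietiesComplex, §1.1.1] -/
theorem proj_nsmul (n : ℕ) (x : κ → ℝ) : ComplexTorus.proj Φ (n • x) = n • ComplexTorus.proj Φ x := by
  funext i
  change ((((n • x) i : ℝ)) : AddCircle (1 : ℝ)) = n • (((x i : ℝ)) : AddCircle (1 : ℝ))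
  rw [Pi.smul_apply, AddCircle.coe_nsmul]

/-- **An `N`-torsion point of `ℝ^ι/ℤ^ι` is the class of `w/N` for an integer vector `w`.**
[cite: Lange2023AbelianVarietiesComplex, §1.1.1] [cite: Hindry1998, §1 item 2] -/
theorem exists_eq_proj_intCast_div_of_nsmul_eq_zero {N : ℕ} (hN : N ≠ 0) (x : ComplexTorus Φ) (hx : N • x = 0) :
    ∃ w : κ → ℤ, x = ComplexTorus.proj Φ fun i ↦ (w i : ℝ) / N := by
  have h1 : ComplexTorus.proj Φ (N • ComplexTorus.lift Φ x) = 0 := by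
    rw [proj_nsmul, ComplexTorus.proj_lift, hx]
  obtain ⟨w, hw⟩ := (ComplexTorus.proj_eq_zero_iff Φ).1 h1
  refine ⟨w, ?_⟩
  have hx' : x = ComplexTorus.proj Φ (ComplexTorus.lift Φ x) := (ComplexTorus.proj_lift Φ x).symm
  rw [hx']
  congr 1
  funext i
  have hi := congr_fun hw i
  simp only [Pi.smul_apply, nsmul_eq_mul] at hi
  have hNr : (N : ℝ) ≠ 0 := Nat.cast_ne_zero.2 hN
  rw [eq_div_iff hNr, mul_comm, hi]
  rfl

/-- **`[w/N] = [w′/N]` when `w ≡ w′ (mod N)` coordinatewise.** [cite: Lange2023AbelianVarietiesComplex, §1.1.1] -/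
theorem proj_intCast_div_eq_of_intCast_eq {N : ℕ} (hN : N ≠ 0) {w w' : κ → ℤ}
    (h : ∀ a, (w a : ZMod N) = (w' a : ZMod N)) :
    (ComplexTorus.proj Φ fun i ↦ (w i : ℝ) / N) = ComplexTorus.proj Φ fun i ↦ (w' i : ℝ) / N := by
  funext i
  rw [ComplexTorus.proj_apply, ComplexTorus.proj_apply]
  obtain ⟨k, hk⟩ := (ZMod.intCast_eq_intCast_iff_dvd_sub (w i) (w' i) N).1 (h i)
  have hNr : (N : ℝ) ≠ 0 := Nat.cast_ne_zero.2 hN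
  have hk' : (w' i : ℝ) = w i + N * k := by exact_mod_cast (sub_eq_iff_eq_add'.1 hk)
  have hdiv : (w' i : ℝ) / N = (w i : ℝ) / N + k := by
    rw [hk']
    field_simp
  have hk0 : ((k : ℝ) : AddCircle (1 : ℝ)) = 0 := (AddCircle.coe_eq_zero_iff (1 : ℝ)).2 ⟨k, by simp⟩
  rw [hdiv, AddCircle.coe_add, hk0, add_zero]

end Torus

end UnivFamilyLevelReadings

end Summit.HodgeConjecture.HodgeConjecture.Theorems

end
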